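import Summits.CriticalPhenomena.PercolationContinuityZ3.Theorems.PercNearOneGluingAdditiveGluingGenPair
import Literature.Probability.Percolation.TwoSetConditionalAssociation
import Literature.Probability.Percolation.KozmaNitzanSeparatingTriple
import HarnessLib

/-!
# The marker-side vdBHK step of (★₁): `E[F(C x) | x↮{o,v}, v↮N₁, o↮v, o↮N₂] ≥ E[F(C x) | x↮{o,v}]`

Support file (`--supports stmt-CriticalPhenomena-4575`, closed crux; independent mathematics on Kozma–Nitzan's Question 8 at
`|A| = 3`), prover `prim-ineq-gen-6` (gen 14).  No definitions, no named facts, no sorries; standard axioms.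
Memo `prim-ineq-gen-6/PROOF-STAR1.md` (Step 4) and `FINDING-G14.md` §4.

Setting: `μ = prodBernoulli w`, owner `x`, observer `o`, marker `v`, vertex sets `N₁` (the vertices the marker must avoid; in (★₁):
the source set `N'`) and `N₂` (the vertices the observer's pocket must avoid besides `x, v`; in (★₁): `Y ∪ N'`), `F` monotone on
vertex sets, `f = F(C x)`;  `N_T = {x↮o} ∩ {x↮v}` (`= {S ↮ T}` for `S = {x}`, `T = {o,v}`) and the "avoidance" event
`A' = {v ↮ N₁} ∩ {o ↮ v} ∩ {o ↮ N₂}`.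
* `PocketCert.pocket_marker_pa` — `(∫_{N_T} f) · μ(N_T ∩ A') ≤ μ(N_T) · ∫_{N_T ∩ A'} f`, i.e. `E[f | N_T ∩ A'] ≥ E[f | N_T]`.
  PROOF: `1_{A'}` is an antitone function of the edge cluster `C_T = C_o ∪ C_v` (each of `{v↔N₁}`, `{o↔v}`, `{o↔N₂}` is read off `C_T`,
  `KNSep.reachable_iff_cluster`, and is increasing in it) and `f` is a monotone function of `C_S = C_x`; van den Berg–Häggström–Kahn's
  Theorem 2.1 at `q = 1` with sets (`BHK2006_twoSetConditionalAssociation`: given `{S↮T}`, functions monotone in `C_S` and antitone in `C_T`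
  are positively correlated) is exactly the claim.  In the proof of (★₁) it turns the decision-tree bound
  `⟨h₁⟩_{N'} ≤ μ(A_ev)·(E f − E[f | A_ev])` (`A_ev = N_T ∩ A'`) into `⟨h₁⟩_{N'} ≤ ⟨α⟩_{N'}·(E f − E[f | N_T])`, which matches the observer half
  `PocketCert.strong_fourPoint`.
[cite: VandenbergHaggstromKahn2005, Thm. 2.1 (p. 9), Remark 1 after Thm. 1.2 (p. 5)] [cite: KozmaNitzan2024, Question 8 (§5.5 p. 36)]
-/

namespace Summit.CriticalPhenomena.PercolationContinuityZ3.Theorems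

open MeasureTheory Set Literature.Probability.LatticeModels Literature.Probability.Percolation
open scoped Classical
open KNPreFKG

noncomputable section

namespace PocketCert

variable {V : Type*} [Fintype V]

/-- **Marker-side positive association under the pocket avoidance.**  Owner `x`, observer `o`, marker `v`, vertex sets `N₁, N₂`,
`F` monotone on vertex sets; `N_T = {x↮o} ∩ {x↮v}`, `A' = {v↮N₁} ∩ {o↮v} ∩ {o↮N₂}`.  Then
`(∫_{N_T} F(C x)) · μ(N_T ∩ A') ≤ μ(N_T) · ∫_{N_T ∩ A'} F(C x)`  (vdBHK Thm 2.1, `q = 1`, `S = {x}`, `T = {o,v}`).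
[cite: VandenbergHaggstromKahn2005, Thm. 2.1 (p. 9)] -/
theorem pocket_marker_pa (w : Sym2 V → unitInterval) (o x v : V) (N₁ N₂ : Set V) (F : Set V → ℝ)
    (hF : ∀ S T : Set V, S ⊆ T → F S ≤ F T) :
    (∫ ω in {ω : BondConfig V | ¬ (openGraph ω).Reachable x o} ∩ {ω | ¬ (openGraph ω).Reachable x v},
        F (openCluster ω x) ∂(prodBernoulli w)) *
      (prodBernoulli w).real (({ω : BondConfig V | ¬ (openGraph ω).Reachable x o} ∩ {ω | ¬ (openGraph ω).Reachable x v}) ∩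
        ({ω | ∀ n ∈ N₁, ¬ (openGraph ω).Reachable v n} ∩ {ω | ¬ (openGraph ω).Reachable o v} ∩
          {ω | ∀ z ∈ N₂, ¬ (openGraph ω).Reachable o z})) ≤
    (prodBernoulli w).real ({ω : BondConfig V | ¬ (openGraph ω).Reachable x o} ∩ {ω | ¬ (openGraph ω).Reachable x v}) *
      ∫ ω in ({ω : BondConfig V | ¬ (openGraph ω).Reachable x o} ∩ {ω | ¬ (openGraph ω).Reachable x v}) ∩
        ({ω | ∀ n ∈ N₁, ¬ (openGraph ω).Reachable v n} ∩ {ω | ¬ (openGraph ω).Reachable o v} ∩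
          {ω | ∀ z ∈ N₂, ¬ (openGraph ω).Reachable o z}), F (openCluster ω x) ∂(prodBernoulli w) := by
  classical
  set μ := prodBernoulli w with hμ
  set f : BondConfig V → ℝ := fun ω => F (openCluster ω x) with hf
  set T0 : Set (BondConfig V) := {ω : BondConfig V | ¬ (openGraph ω).Reachable x o} ∩ {ω | ¬ (openGraph ω).Reachable x v} with hT0
  set Ap : Set (BondConfig V) := {ω : BondConfig V | ∀ n ∈ N₁, ¬ (openGraph ω).Reachable v n} ∩
      {ω | ¬ (openGraph ω).Reachable o v} ∩ {ω | ∀ z ∈ N₂, ¬ (openGraph ω).Reachable o z} with hAp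
  -- vdBHK Thm 2.1 with `S = {x}`, `T = {o, v}`
  set S : Set V := {x} with hS
  set T : Set V := {o, v} with hT
  set Fe : Set (Sym2 V) → Set (Sym2 V) → ℝ := fun C _ => F (openCluster C x) with hFe
  -- the avoidance predicate read on an edge set `D`
  set avoid : Set (Sym2 V) → Prop := fun D =>
    (∀ n ∈ N₁, ¬ (openGraph D).Reachable v n) ∧ ¬ (openGraph D).Reachable o v ∧ ∀ z ∈ N₂, ¬ (openGraph D).Reachable o z
    with havoid
  set Ge : Set (Sym2 V) → Set (Sym2 V) → ℝ := fun _ D => if avoid D then 1 else 0 with hGe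
  have hFe₁ : ∀ D, Monotone fun C => Fe C D := fun D C C' hCC' => hF _ _ (openCluster_mono hCC' x)
  have hFe₂ : ∀ C, Antitone fun D => Fe C D := fun C D D' _ => le_rfl
  have hGe₁ : ∀ D, Monotone fun C => Ge C D := fun D C C' _ => le_rfl
  have havoid_anti : ∀ D D' : Set (Sym2 V), D ⊆ D' → avoid D' → avoid D := by
    intro D D' hDD' h
    refine ⟨fun n hn hr => h.1 n hn (hr.mono (openGraph_mono hDD')), fun hr => h.2.1 (hr.mono (openGraph_mono hDD')),
      fun z hz hr => h.2.2 z hz (hr.mono (openGraph_mono hDD'))⟩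
  have hGe₂ : ∀ C, Antitone fun D => Ge C D := by
    intro C D D' hDD'
    simp only [hGe]
    by_cases h' : avoid D'
    · rw [if_pos h', if_pos (havoid_anti D D' hDD' h')]
    · rw [if_neg h']; split_ifs <;> norm_num
  have hD_ST : {ω : BondConfig V | ∀ s ∈ S, ∀ t ∈ T, ¬ (openGraph ω).Reachable s t} = T0 := by
    ext ω
    simp only [hS, hT, hT0, mem_setOf_eq, mem_inter_iff, mem_insert_iff, mem_singleton_iff, forall_eq_or_imp, forall_eq]
  have hFe_eq : ∀ ω : BondConfig V, Fe (⋃ s ∈ S, openEdgeCluster ω s) (⋃ t ∈ T, openEdgeCluster ω t) = f ω := by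
    intro ω
    simp only [hFe, hf]
    congr 1
    ext a
    exact (KNSep.reachable_iff_cluster ω S (show x ∈ S by simp [hS]) a).symm
  have havoid_eq : ∀ ω : BondConfig V, avoid (⋃ t ∈ T, openEdgeCluster ω t) ↔ ω ∈ Ap := by
    intro ω
    have ho : o ∈ T := by simp [hT]
    have hv : v ∈ T := by simp [hT]
    simp only [havoid, hAp, mem_inter_iff, mem_setOf_eq]
    rw [← KNSep.reachable_iff_cluster ω T ho v]
    constructor
    · rintro ⟨h1, h2, h3⟩
      exact ⟨⟨fun n hn => by rw [KNSep.reachable_iff_cluster ω T hv n]; exact h1 n hn, h2⟩,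
        fun z hz => by rw [KNSep.reachable_iff_cluster ω T ho z]; exact h3 z hz⟩
    · rintro ⟨⟨h1, h2⟩, h3⟩
      exact ⟨fun n hn => by rw [← KNSep.reachable_iff_cluster ω T hv n]; exact h1 n hn, h2,
        fun z hz => by rw [← KNSep.reachable_iff_cluster ω T ho z]; exact h3 z hz⟩
  have hGe_eq : ∀ ω : BondConfig V, Ge (⋃ s ∈ S, openEdgeCluster ω s) (⋃ t ∈ T, openEdgeCluster ω t) = Ap.indicator 1 ω := by
    intro ω
    simp only [hGe]
    by_cases h : ω ∈ Ap
    · rw [if_pos ((havoid_eq ω).2 h), indicator_of_mem h, Pi.one_apply]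
    · rw [if_neg (fun h' => h ((havoid_eq ω).1 h')), indicator_of_notMem h]
  have hBHK := BHK2006_twoSetConditionalAssociation w S T Fe Ge hFe₁ hFe₂ hGe₁ hGe₂
  rw [hD_ST] at hBHK
  simp_rw [hFe_eq, hGe_eq] at hBHK
  rw [setIntegral_mul_indicator_one μ T0 Ap f, setIntegral_indicator_one_eq μ T0 Ap] at hBHK
  exact hBHK

end PocketCert

end

end Summit.CriticalPhenomena.PercolationContinuityZ3.Theorems
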